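import Literature.NumberTheory.EllipticCurves.HeightConductorBoundsModularityProofs
import Mathlib.Algebra.BigOperators.Intervals
import HarnessLib

/-!
# von Känel–Matschke's asymptotic discriminant–conductor inequality from Prop. 10.8 (i)+(iii) (proofs)

Topic `Literature/NumberTheory/EllipticCurves` (family `abc`, LADDER-ABC A1: the *modular method*).
Theorems only — NO new statement (D-0026). von Känel–Matschke, arXiv:1605.06079 = Mem. AMS **286**
(2023) no. 1419 [`VonkanelMatschke2023`], §10.5.3, the display after (eq:szpiro): "and if `N → ∞` then
`log Δ_E ≤ (3/4) ν log N + ((log 2 + o(1))/log log N) ν log N`" — obtained, as the explicit (eq:szpiro),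
from Prop. 10.8 (i) (`2h(E) − κ ≤ log m_f ≤ log r_f ≤ α ≤ β`) now combined with the asymptotic clause
(iii) (`β ≤ (1/8) ν log N + (((1/6) log 2 + o(1))/log log N) ν log N`) and `log Δ_E ≤ 12 h(E) + 16`.

* `half_le_condNu` — `ν(N) ≥ N/2` for `N ≥ 1` (the print uses "Euler's product formula shows that
  `ν ≥ 6N/π²`"; the telescoping bound `∏_{k=2}^{N}(1 − k⁻²) = (N+1)/(2N) ≥ 1/2` suffices here).
* `log_minimalDiscriminant_le_asymptotic_of_prop_10_8` — **the named fact
  `vonKanelMatschke_log_minimalDiscriminant_le_asymptotic` follows from `vonKanelMatschke_prop_10_8_i`,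
  `vonKanelMatschke_prop_10_8_iii` and modularity** (`nonempty_modularParametrizationData`), the
  constant `6κ + 16 ≤ 115.1` being absorbed into the `o(1)`: `115.1 ≤ (δ/2) ν log N / log log N` as soon
  as `N ≥ 460.4/δ` (`ν log N / log log N ≥ N/2`).

No `abc` claim; typed ≠ proved: Prop. 10.8 (i), (iii) and modularity remain named facts.

## References

* [VonkanelMatschke2023] R. von Känel, B. Matschke, arXiv:1605.06079 = Mem. AMS 286 (2023), §10.5.2
  (Prop. 10.8 (i), (iii)), §10.5.3 (display after (eq:szpiro); "ν ≥ 6N/π²").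
-/

noncomputable section

open WeierstrassCurve IsDedekindDomain

namespace Literature.NumberTheory.EllipticCurves.ModularForms

/-! ### `ν ≥ N/2` -/

/-- Telescoping: `∏_{k=2}^{m} (1 − 1/k²) = (m+1)/(2m)` for `m ≥ 1`. [folklore] -/
private theorem prod_Icc_one_sub_one_div_sq {m : ℕ} (hm : 1 ≤ m) :
    ∏ k ∈ Finset.Icc 2 m, (1 - 1 / (k : ℝ) ^ 2) = ((m : ℝ) + 1) / (2 * m) := by
  induction m with
  | zero => omega
  | succ n ih =>
    rcases Nat.eq_zero_or_pos n with h0 | hpos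
    · subst h0
      norm_num
    · rw [Finset.prod_Icc_succ_top (by omega) _, ih hpos]
      have hn : (0 : ℝ) < n := by exact_mod_cast hpos
      push_cast
      field_simp
      ring

/-- **`ν(N) ≥ N/2`** for `N ≥ 1`: every factor `1 − p⁻²` of `ν(N) = N ∏_{p² ∣ N}(1 − p⁻²)` occurs in
`∏_{k=2}^{N}(1 − k⁻²) = (N+1)/(2N) ≥ 1/2`, and the omitted factors are `≤ 1` (a weak form of the printed
"`ν ≥ 6N/π²`"). [cite: VonkanelMatschke2023, §10.5.3 (proof of Prop. 10.8 (ii): "ν ≥ 6N/π²")] -/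
theorem half_le_condNu {N : ℕ} (hN : N ≠ 0) : (N : ℝ) / 2 ≤ condNu N := by
  unfold condNu
  set s : Finset ℕ := N.primeFactors.filter (fun p => p ^ 2 ∣ N) with hs
  have hsub : s ⊆ Finset.Icc 2 N := by
    intro p hp
    have hp' := (Finset.mem_filter.mp hp).1
    exact Finset.mem_Icc.mpr
      ⟨(Nat.prime_of_mem_primeFactors hp').two_le, Nat.le_of_mem_primeFactors hp'⟩
  have hf : ∀ k ∈ Finset.Icc 2 N, 0 ≤ 1 - 1 / (k : ℝ) ^ 2 ∧ 1 - 1 / (k : ℝ) ^ 2 ≤ 1 := by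
    intro k hk
    have hk2 : (2 : ℝ) ≤ k := by exact_mod_cast (Finset.mem_Icc.mp hk).1
    have h1 : 0 < (k : ℝ) ^ 2 := by positivity
    have h2 : 1 / (k : ℝ) ^ 2 ≤ 1 := by rw [div_le_one h1]; nlinarith
    have h3 : 0 ≤ 1 / (k : ℝ) ^ 2 := by positivity
    exact ⟨by linarith, by linarith⟩
  have hsplit := Finset.prod_sdiff (f := fun k : ℕ => 1 - 1 / (k : ℝ) ^ 2) hsub
  have hrest : ∏ k ∈ Finset.Icc 2 N \ s, (1 - 1 / (k : ℝ) ^ 2) ≤ 1 :=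
    Finset.prod_le_one (fun k hk => (hf k (Finset.mem_sdiff.mp hk).1).1)
      (fun k hk => (hf k (Finset.mem_sdiff.mp hk).1).2)
  have hs0 : 0 ≤ ∏ k ∈ s, (1 - 1 / (k : ℝ) ^ 2) := Finset.prod_nonneg fun k hk => (hf k (hsub hk)).1
  have hfull : ∏ k ∈ Finset.Icc 2 N, (1 - 1 / (k : ℝ) ^ 2) = ((N : ℝ) + 1) / (2 * N) :=
    prod_Icc_one_sub_one_div_sq (Nat.one_le_iff_ne_zero.mpr hN)
  have hge : ((N : ℝ) + 1) / (2 * N) ≤ ∏ k ∈ s, (1 - 1 / (k : ℝ) ^ 2) := by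
    rw [← hfull, ← hsplit]
    calc (∏ k ∈ Finset.Icc 2 N \ s, (1 - 1 / (k : ℝ) ^ 2)) * ∏ k ∈ s, (1 - 1 / (k : ℝ) ^ 2)
        ≤ 1 * ∏ k ∈ s, (1 - 1 / (k : ℝ) ^ 2) := mul_le_mul_of_nonneg_right hrest hs0
      _ = _ := one_mul _
  have hN0 : (0 : ℝ) < N := by exact_mod_cast Nat.pos_of_ne_zero hN
  have h12 : (1 : ℝ) / 2 ≤ ((N : ℝ) + 1) / (2 * N) := by
    rw [div_le_div_iff₀ (by norm_num) (by positivity)]; nlinarith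
  calc (N : ℝ) / 2 = N * (1 / 2) := by ring
    _ ≤ N * ∏ k ∈ s, (1 - 1 / (k : ℝ) ^ 2) := mul_le_mul_of_nonneg_left (h12.trans hge) hN0.le

/-! ### The asymptotic discriminant–conductor inequality -/

/-- **vKM, asymptotic (eq:szpiro) ⇐ Prop. 10.8 (i)+(iii)** (PROVED deduction; §10.5.3 "if `N → ∞` then
`log Δ_E ≤ (3/4) ν log N + ((log 2 + o(1))/log log N) ν log N`"): the named fact
`vonKanelMatschke_log_minimalDiscriminant_le_asymptotic` follows from `vonKanelMatschke_prop_10_8_i`,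
`vonKanelMatschke_prop_10_8_iii` and modularity, through `log Δ_E ≤ 12 h(E) + 16 ≤ 6κ + 6β + 16`
(Silverman, proved in the tree) and `6κ + 16 ≤ 115.1 ≤ (δ/2) ν log N / log log N` for `N ≥ 460.4/δ`
(`half_le_condNu`, `log log N ≤ log N`). [cite: VonkanelMatschke2023, §10.5.3 display after (eq:szpiro)] -/
theorem log_minimalDiscriminant_le_asymptotic_of_prop_10_8 (hmod : nonempty_modularParametrizationData)
    (hi : vonKanelMatschke_prop_10_8_i) (hiii : vonKanelMatschke_prop_10_8_iii) :
    vonKanelMatschke_log_minimalDiscriminant_le_asymptotic := by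
  intro δ hδ
  obtain ⟨N₁, hN₁⟩ := hiii (δ / 12) (by positivity)
  obtain ⟨M, hM⟩ := exists_nat_gt (460.4 / δ)
  refine ⟨max N₁ (max 16 M), fun W _ hNW => ?_⟩
  obtain ⟨C, hC⟩ := hasGlobalMinimalModel_rat_holds W
  haveI := hC
  have hNeq : (C • W).conductorNorm ℤ = W.conductorNorm ℤ := conductorNorm_smul_rat W C
  have hΔeq : (C • W).minimalDiscriminantNorm ℤ = W.minimalDiscriminantNorm ℤ :=
    minimalDiscriminantNorm_smul_rat W C
  haveI : NeZero ((C • W).conductorNorm ℤ) := ⟨(conductorNorm_pos_holds (C • W)).ne'⟩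
  obtain ⟨D⟩ := hmod (C • W)
  rw [← hNeq] at hNW
  rw [← hNeq, ← hΔeq, Pasten2024.cast_minimalDiscriminantNorm_eq_abs (C • W)]
  set N : ℕ := (C • W).conductorNorm ℤ with hNdef
  have hN₁N : N₁ ≤ N := le_trans (le_max_left _ _) hNW
  have h16 : 16 ≤ N := le_trans (le_max_left _ _) (le_trans (le_max_right _ _) hNW)
  have hMN : M ≤ N := le_trans (le_max_right _ _) (le_trans (le_max_right _ _) hNW)
  -- Prop. 10.8 (i) for the minimal datum in the class of `D`, and (iii) at `N`
  obtain ⟨W', hW', D', hf, hmin⟩ := Pasten2024.exists_minimal_datum_in_class D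
  obtain ⟨h1, h2, h3⟩ := hi (C • W) N rfl D W' D' hf hmin
  have hα : vkmAlpha N ≤ vkmBeta N := min_le_left _ _
  have hβ := hN₁ N hN₁N
  have hS := pasten2024_log_minimalDiscriminant_le_holds (C • W) D.L D.isNeronLattice
  have hκ := six_mul_vkmKappa_add_sixteen_le
  -- analysis: `ν ≥ N/2`, `log log N ≥ 1`, `log N ≥ log log N`
  have hN' : (16 : ℝ) ≤ N := by exact_mod_cast h16
  have hν := half_le_condNu (N := N) (by omega)
  have hl2 := Real.log_two_gt_d9
  have he := Real.exp_one_lt_d9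
  have hlogN : Real.exp 1 ≤ Real.log (N : ℝ) := by
    have h := Real.log_le_log (by norm_num) hN'
    rw [show (16 : ℝ) = 2 ^ 4 by norm_num, Real.log_pow] at h
    push_cast at h
    linarith
  have hL2 : 1 ≤ Real.log (Real.log (N : ℝ)) := by
    have := Real.log_le_log (Real.exp_pos 1) hlogN
    rwa [Real.log_exp] at this
  have hL2le : Real.log (Real.log (N : ℝ)) ≤ Real.log (N : ℝ) := by
    have := Real.log_le_sub_one_of_pos (show 0 < Real.log (N : ℝ) by linarith [Real.exp_pos 1])
    linarith
  set L₂ : ℝ := Real.log (Real.log (N : ℝ)) with hL₂def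
  set X : ℝ := condNu N * Real.log (N : ℝ) with hXdef
  have hL₂pos : 0 < L₂ := by linarith
  -- `X / L₂ ≥ N/2`, hence `(δ/2)/L₂ · X ≥ δ N / 4 > 115.1`
  have hX : (N : ℝ) / 2 * L₂ ≤ X := mul_le_mul hν hL2le (by linarith) ((condNu_nonneg N))
  have hkey : δ * (N : ℝ) / 4 ≤ δ / 2 / L₂ * X := by
    have h0 : 0 ≤ δ / 2 / L₂ := by positivity
    calc δ * (N : ℝ) / 4 = δ / 2 / L₂ * ((N : ℝ) / 2 * L₂) := by field_simp; ring
      _ ≤ δ / 2 / L₂ * X := mul_le_mul_of_nonneg_left hX h0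
  have hMr : 460.4 < (M : ℝ) * δ := (div_lt_iff₀ hδ).mp hM
  have hMN' : (M : ℝ) ≤ N := by exact_mod_cast hMN
  have habs : 115.1 ≤ δ / 2 / L₂ * X := by nlinarith
  -- assemble: `log Δ ≤ 12h + 16 ≤ 6κ + 6β + 16`
  have hsplit : (Real.log 2 + δ) / L₂ * X =
      6 * ((1 / 6 * Real.log 2 + δ / 12) / L₂ * X) + δ / 2 / L₂ * X := by
    field_simp; ring
  rw [hsplit]
  linarith

end Literature.NumberTheory.EllipticCurves.ModularForms

end
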